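import Summits.QuantumFields.BalabanUV.Beta.GAN24.DirichletVertexPullback
import Summits.QuantumFields.BalabanUV.Beta.GAN24.DirichletRingHessianLocalShift
import Summits.QuantumFields.BalabanUV.Beta.GAN24.DirichletBoxCompression

/-!
# `BalabanUV.Beta.GAN24.DirichletVertexLocal` — binder row G-an2-4 / (CONV-C), road P2 PART IV, leaf L14 (the torus transfer), FILE C2:
# THE UNWEIGHTED HESSIAN NEAR A PRODUCT-PATTERN BLOCK VERTEX, ON THE TORUS (interior, flat face, convex corner, empty star) in `d = 2`
# (unit b2b-balaban-gan24-p2, gen 26, v1)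

HONEST FRAMING (cell contract, verbatim): «discharging `BetaPertH` makes Bałaban's UV stability UNCONDITIONAL — a real constructive-QFT
result; it is NOT the continuum limit and NOT the Clay problem.»  SUPPLIER module under the T⁴-DAG sub-row `T4-U1a.S-NE2-D1-DIRICHLET°`
(owner wording R24 «the full rate L⁻¹ beyond boxes OPEN»).  The vertex census of binder (A) (memo `gen26/L14-TRANSFER.md` §3): at a block
vertex `b` whose star pattern `{p : S (starBlk σ b p)}` is a PRODUCT `A × B` of sign sets (0, 1, 2 adjacent or 4 blocks of the star in `S` —
every pattern except the re-entrant and the checkerboard ones) the pulled-back region `W(i,j) = A(0 ≤ i) ∧ B(0 ≤ j)` is axis-separated, so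
the model brick `DirichletRingHessianLocalShift.local_hessian_le_shift` (p244818) bounds the second differences of the periodic pull-back
`Up u` on the plateau `Q_{2L+c−1}` by window quantities; this file pushes that to the torus.

## Contents ([folklore]; 0 sorry)

* §1 `blockReg_emb_iff`: on the window `[−n,n)²`, `emb σ b i j ∈ Ω ↔ S (starBlk σ b (sgnPat i j))`; the product region `Wprod A B`,
  `axisSep_Wprod`; under `hAB : ∀ p, S (starBlk σ b p) ↔ A (p 0) ∧ B (p 1)`: `blockReg_emb_iff_Wprod`.
* §2 **`vertex_local_hessian_le`** (model form on the torus field): for `u` vanishing off `Ω`, `1 ≤ L`, `K = 4L+c+1 ≤ n − 1`, `2 ≤ M_ν`: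
  `Σ_{Q_{2L+c−1}} 𝟙_W(|d1 Up u|²+|d2 Up u|²) ≤ 2B/n⁴ + (32/L²)·E/n² + (16/L⁴)·nsq u`, `E = ‖∂₀u‖²+‖∂₁u‖²`, `B = Σ_{x∈Ω}|Δu(x)|²`.
* §3 the push-forward weight `plainW` (`𝟙_W` on `Q_P`), exchange, and **`vertex_plain_hessian_le`**:
  `Σ_μ Σ_x plainW_b(x)·|(∂ᴴ_μ∂_μ u)(x)|² ≤ 2B + 32(n/L)²·E + 16(n/L)⁴·nsq u`; §4 for `u = solExt f`: `≤ (4(1+(a′γ′⁻¹)²) + 32(n/L)²γ′⁻¹ +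
  16(n/L)⁴γ′⁻²)·‖f‖²` (`plain_hessian_solExt_le`; with `L = ⌊n/16⌋`, `n ≥ 32`: `n/L ≤ 32`).

ABSOLUTE RULE (cell, verbatim): «No internally-minted statement may enter as a cited fact. Every hypothesis is either kernel-proved in
this package or a verbatim quotation of a PUBLISHED theorem with page reference. The manuscript(s) under audit are NOT citable for
their own disputed steps — they are the thing under adjudication; programme-internal (2001/route/tribunal) claims are never citable.»
Nothing printed is a hypothesis.  NOT CLAIMED: the checkerboard and re-entrant-annulus parts of (A), `ω ≤ w′`, (Φ)/(Φ′), the END; NOT NE2,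
(CONV-C), `BetaPertH`, continuum, Clay.  «not in print; our proof attempt».  HONEST DEPENDENCY: continuum YM on T⁴ ⇐ BetaPertH ∧ nine
spine estimates (0/9 proved); BetaPertH ⇐ (D1) ∧ (D4) ∧ CAP+tail; G-an2-4 gates asym, D1 and NE2/3/4.
-/

noncomputable section

open scoped BigOperators ComplexConjugate Matrix
open Finset

namespace Summit.QuantumFields.BalabanUV.Beta.GAN24.DirichletVertexLocal

open Literature.MathematicalPhysics.QuantumFieldTheory.Balaban1983to89.B5Prop11Plancherel (Tor fine unitVec)
open Literature.MathematicalPhysics.QuantumFieldTheory.Balaban1983to89.B5Action121 (sdiff LapS)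
open Literature.MathematicalPhysics.QuantumFieldTheory.Balaban1983to89.B5Prop11Lower (nsq nsq_nonneg)
open Summit.QuantumFields.BalabanUV.T4Continuum.ScalarAveragedPropagator (gammaPs gammaPs_pos dirichlet)
open Summit.QuantumFields.BalabanUV.Beta.GAN24.DirichletBoxRegularity (Pdir)
open Summit.QuantumFields.BalabanUV.Beta.GAN24.DirichletBoxTrace (blockReg)
open Summit.QuantumFields.BalabanUV.Beta.GAN24.DirichletBoxCompression (solExt solExt_apply_of_not dirichlet_solExt_le
  sum_normSq_LapS_solExt_le nsq_solExt_le)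
open DirichletRingEnergies (lap Et sqSum Et_nonneg sqSum_nonneg)
open DirichletRingCutoff (tIdx one_le_tIdx)
open DirichletRingHessianIdentity (d1 d2)
open DirichletRingHessianLocal (AxisSep indW indW_mem axisSep_prod axisSep_congr)
open DirichletRingHessianLocalShift (local_hessian_le_shift)
open DirichletVertexChart
open DirichletVertexPullback

variable (n : ℕ) [NeZero n] (M : Fin 2 → ℕ) [hM : ∀ μ, NeZero (M μ)]

/-! ## §1 The pulled-back region of a product-pattern vertex -/

section Region

variable {S : Tor M → Prop} {σ : Fin 2 → Bool} {b : Tor M}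

/-- on the window, membership in `Ω` is read off the star pattern: `emb σ b i j ∈ Ω ↔ S (starBlk σ b (sgnPat i j))`. [folklore] -/
theorem blockReg_emb_iff {i j : ℤ} (hi : -(n : ℤ) ≤ i) (hi' : i < n) (hj : -(n : ℤ) ≤ j) (hj' : j < n) :
    blockReg n M S (emb n M σ b i j) ↔ S (starBlk M σ b (sgnPat i j)) := by
  unfold blockReg
  rw [blockOf_emb n M σ b hi hi' hj hj']

omit hM in
/-- the two sign coordinates of `sgnPat`. [folklore] -/
theorem sgnPat_apply (i j : ℤ) : sgnPat i j 0 = decide (0 ≤ i) ∧ sgnPat i j 1 = decide (0 ≤ j) := by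
  simp [sgnPat, cvec]

end Region

/-- the PRODUCT REGION of the sign sets `A`, `B`: `W(i,j) ↔ A(0 ≤ i) ∧ B(0 ≤ j)`. [folklore] -/
def Wprod (A B : Bool → Prop) (i j : ℤ) : Prop := A (decide (0 ≤ i)) ∧ B (decide (0 ≤ j))

/-- decidability of the product region. [folklore] -/
instance decWprod (A B : Bool → Prop) [DecidablePred A] [DecidablePred B] (i j : ℤ) : Decidable (Wprod A B i j) :=
  inferInstanceAs (Decidable (A (decide (0 ≤ i)) ∧ B (decide (0 ≤ j))))

omit hM in
/-- the product region is axis-separated. [folklore] -/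
theorem axisSep_Wprod (A B : Bool → Prop) : AxisSep (Wprod A B) :=
  axisSep_prod (fun i => A (decide (0 ≤ i))) (fun j => B (decide (0 ≤ j)))

section Product

variable {S : Tor M → Prop} {σ : Fin 2 → Bool} {b : Tor M} {A B : Bool → Prop}

/-- under the PRODUCT-PATTERN hypothesis `S (starBlk σ b p) ↔ A (p 0) ∧ B (p 1)`, on the window `emb σ b i j ∈ Ω ↔ Wprod A B i j`. [folklore] -/
theorem blockReg_emb_iff_Wprod (hAB : ∀ p : Fin 2 → Bool, S (starBlk M σ b p) ↔ A (p 0) ∧ B (p 1))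
    {i j : ℤ} (hi : -(n : ℤ) ≤ i) (hi' : i < n) (hj : -(n : ℤ) ≤ j) (hj' : j < n) :
    blockReg n M S (emb n M σ b i j) ↔ Wprod A B i j := by
  rw [blockReg_emb_iff n M hi hi' hj hj', hAB, Wprod, (sgnPat_apply i j).1, (sgnPat_apply i j).2]

end Product

/-! ## §2 The local Hessian of the periodic pull-back -/

section Local

variable {S : Tor M → Prop} {σ : Fin 2 → Bool} {b : Tor M} {A B : Bool → Prop} [DecidablePred A] [DecidablePred B]
  {u : Tor (fine n M) → ℂ}

/-- a `𝟙_W`-weighted square-sum over `Q_K` of `‖F ∘ emb‖²` is a sub-sum of `Σ_{x∈Ω} ‖F x‖²` (no wrap, `W`-sites are `Ω`-sites). [folklore] -/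
theorem sqSum_indW_le [DecidablePred S] (hAB : ∀ p : Fin 2 → Bool, S (starBlk M σ b p) ↔ A (p 0) ∧ B (p 1))
    (F : Tor (fine n M) → ℂ) {K : ℕ} (hK : K ≤ n) (h0 : 2 * K ≤ n * M 0) (h1 : 2 * K ≤ n * M 1) :
    sqSum (fun i j => indW (Wprod A B) i j * ‖F (emb n M σ b i j)‖ ^ 2) K
      ≤ ∑ x ∈ univ.filter (blockReg n M S), ‖F x‖ ^ 2 := by
  set P : Tor (fine n M) → ℝ := fun x => if blockReg n M S x then ‖F x‖ ^ 2 else 0 with hP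
  have hP0 : ∀ x, 0 ≤ P x := fun x => by rw [hP]; simp only; split_ifs <;> positivity
  have hterm : ∀ t ∈ range (2 * K), ∀ s ∈ range (2 * K),
      indW (Wprod A B) (-(K : ℤ) + s) (-(K : ℤ) + t) * ‖F (emb n M σ b (-(K : ℤ) + s) (-(K : ℤ) + t))‖ ^ 2
        ≤ P (emb n M σ b (-(K : ℤ) + s) (-(K : ℤ) + t)) := by
    intro t ht s hs
    simp only [mem_range] at ht hs
    rw [indW, hP]
    simp only
    have hiff := blockReg_emb_iff_Wprod n M hAB (i := -(K : ℤ) + s) (j := -(K : ℤ) + t) (by omega) (by omega) (by omega) (by omega)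
    by_cases hW : Wprod A B (-(K : ℤ) + s) (-(K : ℤ) + t)
    · rw [if_pos hW, if_pos (hiff.mpr hW), one_mul]
    · rw [if_neg hW, zero_mul]; split_ifs <;> positivity
  calc sqSum (fun i j => indW (Wprod A B) i j * ‖F (emb n M σ b i j)‖ ^ 2) K
      ≤ ∑ t ∈ range (2 * K), ∑ s ∈ range (2 * K), P (emb n M σ b (-(K : ℤ) + s) (-(K : ℤ) + t)) :=
        sum_le_sum fun t ht => sum_le_sum fun s hs => hterm t ht s hs
    _ ≤ ∑ x, P x := by
        refine sum_sum_le_univ_of_injOn n M (fun t s => emb n M σ b (-(K : ℤ) + s) (-(K : ℤ) + t)) P hP0 ?_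
        intro t ht s hs t' ht' s' hs' h
        simp only [mem_range] at ht hs ht' hs'
        have := emb_injOn n M (σ := σ) (b := b) (a₀ := -(K : ℤ)) (a₁ := -(K : ℤ)) (W₀ := 2 * K) (W₁ := 2 * K) h0 h1
          (i := -(K : ℤ) + s) (j := -(K : ℤ) + t) (i' := -(K : ℤ) + s') (j' := -(K : ℤ) + t')
          (by omega) (by omega) (by omega) (by omega) (by omega) (by omega) (by omega) (by omega) h
        omega
    _ = _ := by rw [hP, sum_filter]

/-- the site square-sum of the pull-back over `Q_K` is a sub-sum of `nsq u` (no wrap). [folklore] -/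
theorem sqSum_normSq_Up_le (u : Tor (fine n M) → ℂ) {K : ℕ} (h0 : 2 * K ≤ n * M 0) (h1 : 2 * K ≤ n * M 1) :
    sqSum (fun i j => ‖Up n M σ b u i j‖ ^ 2) K ≤ nsq u := by
  rw [nsq]
  refine sum_sum_le_univ_of_injOn n M (fun t s => emb n M σ b (-(K : ℤ) + s) (-(K : ℤ) + t)) (fun x => ‖u x‖ ^ 2)
    (fun _ => sq_nonneg _) ?_
  intro t ht s hs t' ht' s' hs' h
  simp only [mem_range] at ht hs ht' hs'
  have := emb_injOn n M (σ := σ) (b := b) (a₀ := -(K : ℤ)) (a₁ := -(K : ℤ)) (W₀ := 2 * K) (W₁ := 2 * K) h0 h1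
    (i := -(K : ℤ) + s) (j := -(K : ℤ) + t) (i' := -(K : ℤ) + s') (j' := -(K : ℤ) + t')
    (by omega) (by omega) (by omega) (by omega) (by omega) (by omega) (by omega) (by omega) h
  omega

/-- **THE LOCAL HESSIAN OF THE PULL-BACK AT A PRODUCT-PATTERN VERTEX** (lattice units): for `u` vanishing off `Ω`, `1 ≤ L`,
`K = 4L + c + 1 ≤ n − 1`, `2 ≤ M_ν`:
`Σ_{Q_{2L+c−1}} 𝟙_W(|d1 Up u|²+|d2 Up u|²) ≤ 2·(Σ_{x∈Ω}|Δu|²)/n⁴ + (32/L²)(‖∂₀u‖²+‖∂₁u‖²)/n² + (16/L⁴)·nsq u`. [folklore] -/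
theorem vertex_local_hessian_le [DecidablePred S] (hu : ∀ x, ¬ blockReg n M S x → u x = 0)
    (hAB : ∀ p : Fin 2 → Bool, S (starBlk M σ b p) ↔ A (p 0) ∧ B (p 1))
    {L c : ℕ} (hL : 1 ≤ L) (hK : 4 * L + c + 2 ≤ n) (hM0 : 2 ≤ M 0) (hM1 : 2 ≤ M 1) :
    sqSum (fun i j => indW (Wprod A B) i j * (‖d1 (Up n M σ b u) i j‖ ^ 2 + ‖d2 (Up n M σ b u) i j‖ ^ 2)) (2 * L + c - 1)
      ≤ 2 * ((∑ x ∈ univ.filter (blockReg n M S), ‖(LapS (fine n M) (n : ℂ) *ᵥ u) x‖ ^ 2) / (n : ℝ) ^ 4)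
        + 32 / (L : ℝ) ^ 2 * ((nsq (sdiff (fine n M) (n : ℂ) 0 *ᵥ u) + nsq (sdiff (fine n M) (n : ℂ) 1 *ᵥ u)) / (n : ℝ) ^ 2)
        + 16 / (L : ℝ) ^ 4 * nsq u := by
  set K : ℕ := 4 * L + c + 1 with hKdef
  have hKn : K ≤ n := by omega
  have hn0 : (0 : ℝ) < n := by exact_mod_cast Nat.pos_of_ne_zero (NeZero.ne n)
  have hn4 : (0 : ℝ) < (n : ℝ) ^ 4 := by positivity
  have hW0 : 2 * K + 2 ≤ n * M 0 := by have := Nat.mul_le_mul_left n hM0; omega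
  have hW1 : 2 * K + 2 ≤ n * M 1 := by have := Nat.mul_le_mul_left n hM1; omega
  set U : ℤ → ℤ → ℂ := Up n M σ b u with hU
  set G : ℤ → ℤ → ℂ := fun i j => (LapS (fine n M) (n : ℂ) *ᵥ u) (emb n M σ b i j) / (n : ℂ) ^ 2 with hG
  -- hypotheses of the model brick
  have hUW : ∀ i j : ℤ, tIdx i ≤ 4 * (L : ℤ) + c → tIdx j ≤ 4 * (L : ℤ) + c → ¬ Wprod A B i j → U i j = 0 := by
    intro i j hi hj hW
    have hi' : -(n : ℤ) ≤ i ∧ i < n := by unfold tIdx at hi; split_ifs at hi <;> constructor <;> omega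
    have hj' : -(n : ℤ) ≤ j ∧ j < n := by unfold tIdx at hj; split_ifs at hj <;> constructor <;> omega
    exact hu _ (fun h => hW ((blockReg_emb_iff_Wprod n M hAB hi'.1 hi'.2 hj'.1 hj'.2).mp h))
  have hEq : ∀ i j : ℤ, tIdx i ≤ 4 * (L : ℤ) + c + 1 → tIdx j ≤ 4 * (L : ℤ) + c + 1 → Wprod A B i j → lap U i j = G i j := by
    intro i j _ _ _
    have hn2 : (n : ℂ) ^ 2 ≠ 0 := pow_ne_zero 2 (by exact_mod_cast NeZero.ne n)
    show lap U i j = (LapS (fine n M) (n : ℂ) *ᵥ u) (emb n M σ b i j) / (n : ℂ) ^ 2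
    rw [hU, LapS_emb, mul_div_cancel_left₀ _ hn2]
  have hloc := local_hessian_le_shift (Wprod A B) U hL (axisSep_Wprod A B) G hUW hEq
  -- the three window quantities
  have hSG : sqSum (fun i j => indW (Wprod A B) i j * ‖G i j‖ ^ 2) K
      ≤ (∑ x ∈ univ.filter (blockReg n M S), ‖(LapS (fine n M) (n : ℂ) *ᵥ u) x‖ ^ 2) / (n : ℝ) ^ 4 := by
    have h : sqSum (fun i j => indW (Wprod A B) i j * ‖(LapS (fine n M) (n : ℂ) *ᵥ u) (emb n M σ b i j) / (n : ℂ) ^ 2‖ ^ 2) K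
        ≤ ∑ x ∈ univ.filter (blockReg n M S), ‖(LapS (fine n M) (n : ℂ) *ᵥ u) x / (n : ℂ) ^ 2‖ ^ 2 :=
      sqSum_indW_le n M hAB (fun x => (LapS (fine n M) (n : ℂ) *ᵥ u) x / (n : ℂ) ^ 2) hKn (by omega) (by omega)
    have e : ∀ x, ‖(LapS (fine n M) (n : ℂ) *ᵥ u) x / (n : ℂ) ^ 2‖ ^ 2 = ‖(LapS (fine n M) (n : ℂ) *ᵥ u) x‖ ^ 2 / (n : ℝ) ^ 4 := by
      intro x; rw [norm_div, div_pow, norm_pow, Complex.norm_natCast, ← pow_mul]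
    have e2 : (fun i j => indW (Wprod A B) i j * ‖G i j‖ ^ 2)
        = (fun i j => indW (Wprod A B) i j * (‖(LapS (fine n M) (n : ℂ) *ᵥ u) (emb n M σ b i j)‖ ^ 2 / (n : ℝ) ^ 4)) := by
      funext i j; simp only [hG, e]
    simp only [e] at h
    rw [e2, Finset.sum_div]
    exact h
  have hEt : Et U K ≤ (nsq (sdiff (fine n M) (n : ℂ) 0 *ᵥ u) + nsq (sdiff (fine n M) (n : ℂ) 1 *ᵥ u)) / (n : ℝ) ^ 2 := by
    rw [Et_eq_rect, add_div]
    exact add_le_add (EtH_Up_le n M σ b u hW0 (by omega)) (EtV_Up_le n M σ b u (by omega) hW1)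
  have hS : sqSum (fun i j => ‖U i j‖ ^ 2) K ≤ nsq u := sqSum_normSq_Up_le n M u (by omega) (by omega)
  refine hloc.trans ?_
  gcongr

end Local

/-! ## §3 The push-forward of the plateau indicator and the torus bound -/

/-- the PUSHED-FORWARD PLATEAU INDICATOR of the vertex `(σ, b)` with sign sets `A, B` and plateau `P`:
`plainW x = Σ_{(s,t)∈[0,2P)²} [x = emb σ b (−P+s, −P+t)]·𝟙_{Wprod A B}(−P+s, −P+t)`. [folklore] -/
def plainW (v : (Fin 2 → Bool) × Tor M) (A B : Bool → Prop) [DecidablePred A] [DecidablePred B] (P : ℕ) (x : Tor (fine n M)) : ℝ :=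
  ∑ t ∈ range (2 * P), ∑ s ∈ range (2 * P),
    if x = emb n M v.1 v.2 (-(P : ℤ) + s) (-(P : ℤ) + t) then indW (Wprod A B) (-(P : ℤ) + s) (-(P : ℤ) + t) else 0

section Plain

variable {S : Tor M → Prop} {σ : Fin 2 → Bool} {b : Tor M} (A B : Bool → Prop) [DecidablePred A] [DecidablePred B]

omit [NeZero n] hM in
/-- `0 ≤ plainW`. [folklore] -/
theorem plainW_nonneg (v : (Fin 2 → Bool) × Tor M) (P : ℕ) (x : Tor (fine n M)) : 0 ≤ plainW n M v A B P x := by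
  refine sum_nonneg fun t _ => sum_nonneg fun s _ => ?_
  split_ifs
  · exact (indW_mem _ _ _).1
  · exact le_rfl

/-- **EXCHANGE OF SUMS** for `plainW`. [folklore] -/
theorem sum_plainW_mul (v : (Fin 2 → Bool) × Tor M) (P : ℕ) (F : Tor (fine n M) → ℝ) :
    ∑ x, plainW n M v A B P x * F x
      = ∑ t ∈ range (2 * P), ∑ s ∈ range (2 * P),
          indW (Wprod A B) (-(P : ℤ) + s) (-(P : ℤ) + t) * F (emb n M v.1 v.2 (-(P : ℤ) + s) (-(P : ℤ) + t)) := by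
  simp only [plainW, sum_mul]
  rw [sum_comm]
  refine sum_congr rfl fun t _ => ?_
  rw [sum_comm]
  refine sum_congr rfl fun s _ => ?_
  simp only [ite_mul, zero_mul, sum_ite_eq', mem_univ, if_true]

variable {A B} {u : Tor (fine n M) → ℂ}

/-- **THE UNWEIGHTED HESSIAN CHARGED TO A PRODUCT-PATTERN VERTEX**: for `u` vanishing off `Ω`, `1 ≤ L`, `4L + c + 2 ≤ n`, `2 ≤ M_ν`, with
plateau `P = 2L + c − 1`:
`Σ_μ Σ_x plainW_{(σ,b)}(x)·|(∂ᴴ_μ∂_μ u)(x)|² ≤ 2·Σ_{x∈Ω}|Δu|² + 32(n/L)²·(‖∂₀u‖²+‖∂₁u‖²) + 16(n/L)⁴·nsq u`. [folklore] -/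
theorem vertex_plain_hessian_le [DecidablePred S] (hu : ∀ x, ¬ blockReg n M S x → u x = 0)
    (hAB : ∀ p : Fin 2 → Bool, S (starBlk M σ b p) ↔ A (p 0) ∧ B (p 1))
    {L c : ℕ} (hL : 1 ≤ L) (hK : 4 * L + c + 2 ≤ n) (hM0 : 2 ≤ M 0) (hM1 : 2 ≤ M 1) :
    ∑ μ, ∑ x, plainW n M (σ, b) A B (2 * L + c - 1) x * ‖(Pdir (fine n M) (n : ℂ) μ *ᵥ u) x‖ ^ 2
      ≤ 2 * ∑ x ∈ univ.filter (blockReg n M S), ‖(LapS (fine n M) (n : ℂ) *ᵥ u) x‖ ^ 2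
        + 32 * ((n : ℝ) / L) ^ 2 * (nsq (sdiff (fine n M) (n : ℂ) 0 *ᵥ u) + nsq (sdiff (fine n M) (n : ℂ) 1 *ᵥ u))
        + 16 * ((n : ℝ) / L) ^ 4 * nsq u := by
  set P : ℕ := 2 * L + c - 1 with hP
  have hn0 : (0 : ℝ) < n := by exact_mod_cast Nat.pos_of_ne_zero (NeZero.ne n)
  have hL0 : (0 : ℝ) < L := by exact_mod_cast hL
  have hloc := vertex_local_hessian_le n M hu hAB hL hK hM0 hM1
  -- exchange of sums and the dictionary: LHS = n⁴·sqSum(𝟙_W·(|d1 Up|²+|d2 Up|²)) P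
  have step1 : ∑ μ, ∑ x, plainW n M (σ, b) A B P x * ‖(Pdir (fine n M) (n : ℂ) μ *ᵥ u) x‖ ^ 2
      = (n : ℝ) ^ 4 * sqSum (fun i j => indW (Wprod A B) i j * (‖d1 (Up n M σ b u) i j‖ ^ 2 + ‖d2 (Up n M σ b u) i j‖ ^ 2)) P := by
    rw [Fin.sum_univ_two, sum_plainW_mul, sum_plainW_mul, ← sum_add_distrib, sqSum, mul_sum]
    refine sum_congr rfl fun t _ => ?_
    rw [← sum_add_distrib, mul_sum]
    refine sum_congr rfl fun s _ => ?_
    rw [Pdir_emb_fst, Pdir_emb_snd, norm_mul, norm_mul, norm_neg, norm_pow, Complex.norm_natCast, mul_pow, mul_pow, ← pow_mul]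
    ring
  rw [step1]
  have e : (n : ℝ) ^ 4 * (2 * ((∑ x ∈ univ.filter (blockReg n M S), ‖(LapS (fine n M) (n : ℂ) *ᵥ u) x‖ ^ 2) / (n : ℝ) ^ 4)
        + 32 / (L : ℝ) ^ 2 * ((nsq (sdiff (fine n M) (n : ℂ) 0 *ᵥ u) + nsq (sdiff (fine n M) (n : ℂ) 1 *ᵥ u)) / (n : ℝ) ^ 2)
        + 16 / (L : ℝ) ^ 4 * nsq u)
      = 2 * ∑ x ∈ univ.filter (blockReg n M S), ‖(LapS (fine n M) (n : ℂ) *ᵥ u) x‖ ^ 2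
        + 32 * ((n : ℝ) / L) ^ 2 * (nsq (sdiff (fine n M) (n : ℂ) 0 *ᵥ u) + nsq (sdiff (fine n M) (n : ℂ) 1 *ᵥ u))
        + 16 * ((n : ℝ) / L) ^ 4 * nsq u := by
    field_simp
  rw [← e]
  exact mul_le_mul_of_nonneg_left hloc (by positivity)

/-! ## §4 For the Dirichlet solution -/

variable (S) (a' : ℝ)

/-- **THE UNWEIGHTED HESSIAN OF THE DIRICHLET SOLUTION CHARGED TO A PRODUCT-PATTERN VERTEX**: for `u = solExt n M a′ Ω f`,
`Σ_μ Σ_x plainW_{(σ,b)}(x)·|(∂ᴴ_μ∂_μ u)(x)|² ≤ (4(1+(a′γ′⁻¹)²) + 32(n/L)²γ′⁻¹ + 16(n/L)⁴γ′⁻²)·‖f‖²`. [folklore] -/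
theorem plain_hessian_solExt_le [DecidablePred S]
    (hAB : ∀ p : Fin 2 → Bool, S (starBlk M σ b p) ↔ A (p 0) ∧ B (p 1))
    {L c : ℕ} (hL : 1 ≤ L) (hK : 4 * L + c + 2 ≤ n) (hM0 : 2 ≤ M 0) (hM1 : 2 ≤ M 1) (ha' : 0 < a')
    (f : {y // blockReg n M S y} → ℂ) :
    ∑ μ, ∑ x, plainW n M (σ, b) A B (2 * L + c - 1) x * ‖(Pdir (fine n M) (n : ℂ) μ *ᵥ solExt n M a' (blockReg n M S) f) x‖ ^ 2
      ≤ (4 * (1 + (a' * (gammaPs 2 a')⁻¹) ^ 2) + 32 * ((n : ℝ) / L) ^ 2 * (gammaPs 2 a')⁻¹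
          + 16 * ((n : ℝ) / L) ^ 4 * ((gammaPs 2 a')⁻¹) ^ 2) * nsq f := by
  set u := solExt n M a' (blockReg n M S) f with hu
  have hu0 : ∀ x, ¬ blockReg n M S x → u x = 0 := fun x hx => solExt_apply_of_not n M a' _ f hx
  have hγp := (gammaPs_pos (d := 2) (a' := a')).1
  have hE : nsq (sdiff (fine n M) (n : ℂ) 0 *ᵥ u) + nsq (sdiff (fine n M) (n : ℂ) 1 *ᵥ u) ≤ (gammaPs 2 a')⁻¹ * nsq f := by
    have h := dirichlet_solExt_le n M a' (blockReg n M S) ha' f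
    rw [dirichlet, Fin.sum_univ_two] at h
    exact h
  have hB : ∑ x ∈ univ.filter (blockReg n M S), ‖(LapS (fine n M) (n : ℂ) *ᵥ u) x‖ ^ 2 ≤ 2 * (1 + (a' * (gammaPs 2 a')⁻¹) ^ 2) * nsq f := by
    rw [Finset.sum_subtype (univ.filter (blockReg n M S)) (p := blockReg n M S) (fun x => by simp)
      (fun x => ‖(LapS (fine n M) (n : ℂ) *ᵥ u) x‖ ^ 2)]
    exact sum_normSq_LapS_solExt_le n M a' (blockReg n M S) ha' f
  have hN : nsq u ≤ ((gammaPs 2 a')⁻¹) ^ 2 * nsq f := nsq_solExt_le n M a' (blockReg n M S) ha' f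
  have hf0 := nsq_nonneg f
  have h := vertex_plain_hessian_le n M (σ := σ) (b := b) (A := A) (B := B) hu0 hAB hL hK hM0 hM1
  refine h.trans ?_
  have hn0 : (0 : ℝ) ≤ ((n : ℝ) / L) ^ 2 := sq_nonneg _
  have hn4 : (0 : ℝ) ≤ ((n : ℝ) / L) ^ 4 := by positivity
  nlinarith [mul_le_mul_of_nonneg_left hE (by positivity : (0 : ℝ) ≤ 32 * ((n : ℝ) / L) ^ 2),
    mul_le_mul_of_nonneg_left hN (by positivity : (0 : ℝ) ≤ 16 * ((n : ℝ) / L) ^ 4)]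

end Plain

end Summit.QuantumFields.BalabanUV.Beta.GAN24.DirichletVertexLocal

end
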